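import Summits.Ventures.PercRepro.C041TriangleLeafMarkStar3Mark0A
import Summits.Ventures.PercRepro.C041TriangleLeafMarkStar3Mark0B
import Summits.Ventures.PercRepro.C041TriangleLeafMarkStar3Mark0C
import Summits.Ventures.PercRepro.C041TriangleLeafMarkStar3Mark0D
import Summits.Ventures.PercRepro.C041TriangleLeafMarkStar3Mark0E
import Summits.Ventures.PercRepro.C041TriangleLeafMarkStar3Mark0F
import Summits.Ventures.PercRepro.C041TriangleLeafMarkStar3Mark0G
import Summits.Ventures.PercRepro.C041TriangleLeafMarkStar3Mark0H
import Summits.Ventures.PercRepro.C041TriangleLeafMarkStar3Mark0I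

/-!
# THEOREM (LEAF + 1-MARK × THREE LEAVES + 2-MARK) — coordinate 4 of the identity `θ_△(v d * v 1, v a * v b * v c * v 0) = leafMarkStar3Mark0A a b c d + leafMarkStar3Mark0B a b c d + leafMarkStar3Mark0C a b c d + leafMarkStar3Mark0D a b c d + leafMarkStar3Mark0E a b c d + leafMarkStar3Mark0F a b c d + leafMarkStar3Mark0G a b c d + leafMarkStar3Mark0H a b c d + leafMarkStar3Mark0I a b c d` (mine-3, gen 67; C-041.md §21 (bg)): the
explicit certificate's coordinate 4 agrees with the triangle map's, by `ring` over the parts' definitions (one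
coordinate per module: the six expansions of 1607 terms each exceed one farm node together).
-/

namespace PercRepro

namespace RelaxedTriangle

open TreeClosure

set_option maxHeartbeats 800000 in
/-- Coordinate 4 of the identity. -/
theorem thetaTri_leafMarkStar3Mark0_coord4 (a b c d : ℝ) :
    thetaTri (v d * v 1) (v a * v b * v c * v 0) 4 = (leafMarkStar3Mark0A a b c d + leafMarkStar3Mark0B a b c d + leafMarkStar3Mark0C a b c d + leafMarkStar3Mark0D a b c d + leafMarkStar3Mark0E a b c d + leafMarkStar3Mark0F a b c d + leafMarkStar3Mark0G a b c d + leafMarkStar3Mark0H a b c d + leafMarkStar3Mark0I a b c d) 4 := by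
  simp only [leafMarkStar3Mark0A, leafMarkStar3Mark0B, leafMarkStar3Mark0C, leafMarkStar3Mark0D, leafMarkStar3Mark0E, leafMarkStar3Mark0F, leafMarkStar3Mark0G, leafMarkStar3Mark0H, leafMarkStar3Mark0I, leafMarkStar3Mark0A1, leafMarkStar3Mark0A2, leafMarkStar3Mark0A3, leafMarkStar3Mark0B1, leafMarkStar3Mark0B2, leafMarkStar3Mark0B3, leafMarkStar3Mark0C1, leafMarkStar3Mark0C2, leafMarkStar3Mark0C3, leafMarkStar3Mark0C4, leafMarkStar3Mark0C5, leafMarkStar3Mark0C6, leafMarkStar3Mark0C7, leafMarkStar3Mark0D1, leafMarkStar3Mark0D2, leafMarkStar3Mark0D3, leafMarkStar3Mark0D4, leafMarkStar3Mark0E1, leafMarkStar3Mark0E2, leafMarkStar3Mark0E3, leafMarkStar3Mark0E4, leafMarkStar3Mark0E5, leafMarkStar3Mark0F1, leafMarkStar3Mark0F2, leafMarkStar3Mark0F3, leafMarkStar3Mark0F4, leafMarkStar3Mark0F5, leafMarkStar3Mark0F6, leafMarkStar3Mark0F7, leafMarkStar3Mark0F8, leafMarkStar3Mark0G1, leafMarkStar3Mark0G2,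 leafMarkStar3Mark0G3, leafMarkStar3Mark0G4, leafMarkStar3Mark0G5, leafMarkStar3Mark0G6, leafMarkStar3Mark0G7, leafMarkStar3Mark0G8, leafMarkStar3Mark0H1, leafMarkStar3Mark0H2, leafMarkStar3Mark0H3, leafMarkStar3Mark0H4, leafMarkStar3Mark0H5, leafMarkStar3Mark0H6, leafMarkStar3Mark0H7, leafMarkStar3Mark0H8, leafMarkStar3Mark0I1, thetaTri_eq_vec, Pi.add_apply, Pi.smul_apply, Pi.mul_apply, Pi.one_apply, smul_eq_mul, v]
  simp
  ring

end RelaxedTriangle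

end PercRepro
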